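import Literature.NumberTheory.LFunctions.PrimitiveQuadraticCharacterKronecker
import Literature.NumberTheory.LFunctions.BernoulliOneCharHalfSum
import HarnessLib

/-!
# Odd primitive quadratic characters: kernel-computable (Euler-criterion) values and `B₁` as an integer sum

Topic `Literature/NumberTheory/LFunctions`, namespace `Literature.NumberTheory.LFunctions.PrimitiveQuadratic` (continuing
`PrimitiveQuadraticCharacterKronecker.lean`: an odd primitive quadratic character mod `f` is the Kronecker symbol `(−f/·)`, with
`f = m`, `4m` or `8m`, `m` odd squarefree).  Everything here is PROVED (theorems only, no definitions, no named facts, no `sorry`).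

THE POINT.  Mathlib's `jacobiSym` evaluates through `Nat.primeFactorsList` (well-founded recursion) and `legendreSym` through the
enumeration of squares, so neither reduces in the kernel at the sizes needed for class-number certificates (`f` up to `2·10⁴`).
Here the values of an odd primitive quadratic character `ψ` mod `f` are rewritten as CLOSED ARITHMETIC EXPRESSIONS in a given list
`ps` of the odd prime factors of the conductor — Euler's criterion `(b/p) = [b^{(p−1)/2} mod p]` factor by factor, times the
`2`-part `χ₄` (conductor `4m`) or `χ₈`/`χ₄χ₈` (conductor `8m`, according as `m ≡ 3, 1 (mod 4)`) — and the generalized Bernoulli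
number `B_{1,ψ} = f⁻¹ Σ_{b<f} ψ(b) b` becomes an INTEGER SUM: `‖B_{1,ψ}‖ = |Σ_{b<f} F(b)(2b − f)|/(2f)`, and for odd `f` the half sums
`‖B_{1,ψ}‖ = |Σ_{b<f/2} F(b)|/3` (`ψ(2) = −1`) or `|Σ_{b<f/2} F(b)|` (`ψ(2) = +1`) of Ireland–Rosen / Borevich–Shafarevich
(`(2 − χ(2))h = Σ_{x<f/2} χ(x)`), so that `h(−f)`-type quantities are decided by `decide` from the factor list alone.

## What is proved

* §1 `legendreSym_natCast_eq_ite` (Euler's criterion, computable form), `jacobiSym_natCast_listProd_eq_prod_ite`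
  (`(b/∏ps) = ∏_{p∈ps} ε_p(b)` for a list of odd primes).
* §2 **`apply_natCast_eq_prod_ite_of_odd`** (`f` odd: `ψ(b) = ∏_{p∈ps} ε_p(b)`), **`apply_natCast_eq_prod_ite_of_eq_four_mul`**
  (`f = 4m`: `ψ(b) = χ₄(b)·∏ε_p(b)`), **`apply_natCast_eq_prod_ite_of_eq_eight_mul`** (`f = 8m`: `ψ(b) = η₈(b)·∏ε_p(b)`,
  `η₈ = χ₄χ₈` if `m ≡ 1 (4)`, `χ₈` if `m ≡ 3 (4)`), for every natural number `b` and any list `ps` of primes with product `m`.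
* §3 **`norm_bernoulliOneChar_eq_natAbs_sum_div`**
  (`‖B_{1,ψ}‖ = |Σ_{b<f} F(b)(2b − f)|/(2f)` whenever `ψ(b) = F(b)` on `b < f`), **`norm_bernoulliOneChar_eq_natAbs_halfSum_div_three`**,
  **`norm_bernoulliOneChar_eq_natAbs_halfSum`** (odd `f`, `ψ(2) = ∓1`).

## References

* [MontgomeryVaughan2007] H. L. Montgomery, R. C. Vaughan, *Multiplicative Number Theory I*, CUP 2007, §9.3 Thm. 9.13.
* [IrelandRosen1982] K. Ireland, M. Rosen, *A Classical Introduction to Modern Number Theory*, GTM 84, Ch. 5 §1 Prop. 5.1.2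
  (Euler's criterion), Ch. 8 Exercise 28, Ch. 15 §2 (`(2 − (2/p))h = Σ_{x<p/2}(x/p)`).
* [Lang1990] S. Lang, *Cyclotomic Fields I and II*, GTM 121, Ch. 2 §1 (`B_{1,χ}`).

## Provenance

Literature seat `lit-deligne-3` gen 45 of cell `pub-hodgecm2` (the Koblitz-list series of `Literature/AlgebraicGeometry/ComplexMultiplication`
consumes these through the class-number certificates of `QuadraticBernoulliCertificates*`).  HC_CM is NOT proved and nothing here bears on it.
-/

noncomputable section

open DirichletCharacter Finset
open scoped NumberTheorySymbols

namespace Literature.NumberTheory.LFunctions.PrimitiveQuadratic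

/-! ## §1 Euler's criterion for the Legendre and Jacobi symbols, computable form -/

/-- **Euler's criterion, computable form**: for an odd prime `p` and `b : ℕ`, `(b/p) = 0` if `p ∣ b`, else `+1` or `−1` according as
`b^{(p−1)/2} ≡ 1 (mod p)` or not (`p / 2 = (p − 1)/2`). [cite: IrelandRosen1982, Ch. 5 §1 Prop. 5.1.2] -/
theorem legendreSym_natCast_eq_ite (p : ℕ) [hp : Fact p.Prime] (hp2 : p ≠ 2) (b : ℕ) :
    legendreSym p b = if b % p = 0 then 0 else if b ^ (p / 2) % p = 1 then 1 else -1 := by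
  have hF : ringChar (ZMod p) ≠ 2 := by rwa [ZMod.ringChar_zmod_n]
  unfold legendreSym
  rw [Int.cast_natCast]
  by_cases hb : b % p = 0
  · rw [if_pos hb, (ZMod.natCast_eq_zero_iff b p).2 (Nat.dvd_of_mod_eq_zero hb), MulChar.map_zero]
  · rw [if_neg hb]
    have hb' : (b : ZMod p) ≠ 0 := fun h => hb (Nat.mod_eq_zero_of_dvd ((ZMod.natCast_eq_zero_iff b p).1 h))
    rw [quadraticChar_eq_pow_of_char_ne_two hF hb', ZMod.card]
    have hiff : (b : ZMod p) ^ (p / 2) = 1 ↔ b ^ (p / 2) % p = 1 := by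
      rw [← Nat.cast_pow, ← Nat.cast_one (R := ZMod p), ZMod.natCast_eq_natCast_iff', Nat.mod_eq_of_lt hp.out.one_lt]
    by_cases h : b ^ (p / 2) % p = 1
    · rw [if_pos h, if_pos (hiff.2 h)]
    · rw [if_neg h, if_neg (mt hiff.1 h)]

/-- **The Jacobi symbol with an explicitly factored odd denominator**: for a list `ps` of odd primes and `b : ℕ`,
`(b / ∏ps) = ∏_{p ∈ ps} ε_p(b)` with `ε_p` Euler's criterion sign. [cite: IrelandRosen1982, Ch. 5 §1 Prop. 5.1.2] -/
theorem jacobiSym_natCast_listProd_eq_prod_ite (ps : List ℕ) (hps : ∀ p ∈ ps, p.Prime ∧ p ≠ 2) (b : ℕ) :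
    J((b : ℤ) | ps.prod) = (ps.map fun p => if b % p = 0 then (0 : ℤ) else if b ^ (p / 2) % p = 1 then 1 else -1).prod := by
  induction ps with
  | nil => simp
  | cons p ps ih =>
    have hp := (hps p List.mem_cons_self).1
    have hp2 := (hps p List.mem_cons_self).2
    haveI : Fact p.Prime := ⟨hp⟩
    have hrest : ∀ q ∈ ps, q.Prime ∧ q ≠ 2 := fun q hq => hps q (List.mem_cons_of_mem _ hq)
    have hps0 : ps.prod ≠ 0 := by
      rw [Ne, List.prod_eq_zero_iff]
      exact fun h0 => (hrest 0 h0).1.ne_zero rfl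
    rw [List.prod_cons, jacobiSym.mul_right' _ hp.ne_zero hps0, ← jacobiSym.legendreSym.to_jacobiSym,
      legendreSym_natCast_eq_ite p hp2 b, List.map_cons, List.prod_cons, ih hrest]

/-! ## §2 The values of an odd primitive quadratic character as closed arithmetic expressions -/

section Values

variable {f : ℕ} [NeZero f] {ψ : DirichletCharacter ℂ f}

/-- **ODD CONDUCTOR**: for `ψ` primitive quadratic mod an odd `f` and any list `ps` of primes with `∏ps = f` (so `f` is squarefree and
`ps` is its list of prime factors): `ψ(b) = ∏_{p∈ps} ε_p(b)` for every `b : ℕ` — the Jacobi symbol `(b/f)` through Euler's criterion.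
[cite: MontgomeryVaughan2007, §9.3 Thm. 9.13] [cite: IrelandRosen1982, Ch. 5 §1 Prop. 5.1.2] -/
theorem apply_natCast_eq_prod_ite_of_odd (hf : Odd f) (hprim : ψ.IsPrimitive) (hquad : ψ.IsQuadratic) {ps : List ℕ}
    (hps : ∀ p ∈ ps, p.Prime) (hprod : ps.prod = f) (b : ℕ) :
    ψ (b : ZMod f) = (((ps.map fun p => if b % p = 0 then (0 : ℤ) else if b ^ (p / 2) % p = 1 then 1 else -1).prod : ℤ) : ℂ) := by
  have hsq := squarefree_of_isPrimitive_of_isQuadratic hf hprim hquad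
  have hodd : ∀ p ∈ ps, p.Prime ∧ p ≠ 2 := by
    intro p hp
    refine ⟨hps p hp, fun h2 => ?_⟩
    have hdvd : p ∣ f := hprod ▸ List.dvd_prod hp
    rw [h2] at hdvd
    exact (Nat.not_even_iff_odd.2 hf) (even_iff_two_dvd.2 hdvd)
  have hJ : J((b : ℤ) | f) = (ps.map fun p => if b % p = 0 then (0 : ℤ) else if b ^ (p / 2) % p = 1 then 1 else -1).prod := by
    rw [← hprod]; exact jacobiSym_natCast_listProd_eq_prod_ite ps hodd b
  rw [apply_natCast_eq_jacobiSym hf hsq ψ hprim hquad b, hJ]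

/-- An even number is not a unit modulo `4`, nor modulo `8`. [folklore] -/
private theorem not_isUnit_of_even {k : ℕ} (hk : k = 2 ∨ k = 3) {b : ℕ} (hb : b % 2 = 0) : ¬IsUnit ((b : ℕ) : ZMod (2 ^ k)) := by
  rw [ZMod.isUnit_iff_coprime]
  intro h
  have h2 : Nat.Coprime b 2 := by
    rcases hk with rfl | rfl
    · exact Nat.Coprime.coprime_dvd_right (by norm_num) h
    · exact Nat.Coprime.coprime_dvd_right (by norm_num) h
  rw [Nat.coprime_two_right, Nat.odd_iff] at h2
  omega

/-- **CONDUCTOR `4m`**: for `ψ` odd primitive quadratic mod `f = 4m`, `m` odd, and any list `ps` of primes with `∏ps = m`: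
`ψ(b) = χ₄(b)·∏_{p∈ps} ε_p(b)` for every `b : ℕ` (`χ₄(b) = 0, 1, −1` for `b` even, `≡ 1`, `≡ 3 (mod 4)`).
[cite: MontgomeryVaughan2007, §9.3 Thm. 9.13] [cite: IrelandRosen1982, Ch. 5 §1 Prop. 5.1.2] -/
theorem apply_natCast_eq_prod_ite_of_eq_four_mul {m : ℕ} (hfm : f = 4 * m) (hm : Odd m) (hprim : ψ.IsPrimitive)
    (hquad : ψ.IsQuadratic) {ps : List ℕ} (hps : ∀ p ∈ ps, p.Prime) (hprod : ps.prod = m) (b : ℕ) :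
    ψ (b : ZMod f) = (((if b % 2 = 0 then (0 : ℤ) else if b % 4 = 1 then 1 else -1) *
      (ps.map fun p => if b % p = 0 then (0 : ℤ) else if b ^ (p / 2) % p = 1 then 1 else -1).prod : ℤ) : ℂ) := by
  subst hfm
  haveI : NeZero m := ⟨fun h => by simp [h] at hm⟩
  have hcop := coprime_two_pow_of_odd 2 hm
  have key := apply_natCast_eq_crtFst_mul_jacobiSym (k := 2) hm (χ := ψ) hprim hquad b
  have hodd : ∀ p ∈ ps, p.Prime ∧ p ≠ 2 := by
    intro p hp
    refine ⟨hps p hp, fun h2 => ?_⟩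
    have hdvd : p ∣ m := hprod ▸ List.dvd_prod hp
    rw [h2] at hdvd
    exact (Nat.not_even_iff_odd.2 hm) (even_iff_two_dvd.2 hdvd)
  have hJ : J((b : ℤ) | m) = (ps.map fun p => if b % p = 0 then (0 : ℤ) else if b ^ (p / 2) % p = 1 then 1 else -1).prod := by
    rw [← hprod]; exact jacobiSym_natCast_listProd_eq_prod_ite ps hodd b
  have h2 : crtFst hcop ψ ((b : ℕ) : ZMod (2 ^ 2)) = ((if b % 2 = 0 then (0 : ℤ) else if b % 4 = 1 then 1 else -1 : ℤ) : ℂ) := by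
    by_cases hb : b % 2 = 0
    · rw [if_pos hb, MulChar.map_nonunit _ (not_isUnit_of_even (Or.inl rfl) hb), Int.cast_zero]
    · rw [if_neg hb]
      have hbodd : Odd b := Nat.odd_iff.2 (by omega)
      rw [show ((b : ℕ) : ZMod (2 ^ 2)) = ((b : ℕ) : ZMod 4) from rfl,
        apply_natCast_four_eq (isPrimitive_crtFst hcop hprim) (IsQuadratic.crtFst hcop hquad) hbodd, jacobiSym.at_neg_one hbodd,
        ZMod.χ₄_nat_eq_if_mod_four, if_neg hb]
  rw [show ((b : ℕ) : ZMod (4 * m)) = ((b : ℕ) : ZMod (2 ^ 2 * m)) from rfl, key, h2, hJ, Int.cast_mul]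

/-- **CONDUCTOR `8m`**: for `ψ` ODD primitive quadratic mod `f = 8m`, `m` odd, and any list `ps` of primes with `∏ps = m`:
`ψ(b) = η₈(b)·∏_{p∈ps} ε_p(b)` for every `b : ℕ`, where `η₈ = χ₄χ₈` (`+1` at `b ≡ 1, 3 (mod 8)`) if `m ≡ 1 (mod 4)` and `η₈ = χ₈`
(`+1` at `b ≡ 1, 7 (mod 8)`) if `m ≡ 3 (mod 4)` — the parity `ψ(−1) = −1` fixes the component at `2` (`χ₂(3) = χ₄(m)`).
[cite: MontgomeryVaughan2007, §9.3 Thm. 9.13] [cite: IrelandRosen1982, Ch. 5 §1 Prop. 5.1.2] -/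
theorem apply_natCast_eq_prod_ite_of_eq_eight_mul {m : ℕ} (hfm : f = 8 * m) (hm : Odd m) (hprim : ψ.IsPrimitive)
    (hquad : ψ.IsQuadratic) (hodd : ψ.Odd) {ps : List ℕ} (hps : ∀ p ∈ ps, p.Prime) (hprod : ps.prod = m) (b : ℕ) :
    ψ (b : ZMod f) = (((if b % 2 = 0 then (0 : ℤ) else if m % 4 = 1 then (if b % 8 = 1 ∨ b % 8 = 3 then 1 else -1)
        else (if b % 8 = 1 ∨ b % 8 = 7 then 1 else -1)) *
      (ps.map fun p => if b % p = 0 then (0 : ℤ) else if b ^ (p / 2) % p = 1 then 1 else -1).prod : ℤ) : ℂ) := by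
  subst hfm
  haveI : NeZero m := ⟨fun h => by simp [h] at hm⟩
  have hcop := coprime_two_pow_of_odd 3 hm
  have key := apply_natCast_eq_crtFst_mul_jacobiSym (k := 3) hm (χ := ψ) hprim hquad b
  have hpodd : ∀ p ∈ ps, p.Prime ∧ p ≠ 2 := by
    intro p hp
    refine ⟨hps p hp, fun h2 => ?_⟩
    have hdvd : p ∣ m := hprod ▸ List.dvd_prod hp
    rw [h2] at hdvd
    exact (Nat.not_even_iff_odd.2 hm) (even_iff_two_dvd.2 hdvd)
  have hJ : J((b : ℤ) | m) = (ps.map fun p => if b % p = 0 then (0 : ℤ) else if b ^ (p / 2) % p = 1 then 1 else -1).prod := by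
    rw [← hprod]; exact jacobiSym_natCast_listProd_eq_prod_ite ps hpodd b
  have h3 := crtFst_three_eq_of_level_eight_mul hm (χ := ψ) hprim hquad hodd
  rw [χ₄_cast_eq_ite hm] at h3
  have h2 : crtFst hcop ψ ((b : ℕ) : ZMod (2 ^ 3)) = ((if b % 2 = 0 then (0 : ℤ) else if m % 4 = 1 then
      (if b % 8 = 1 ∨ b % 8 = 3 then 1 else -1) else (if b % 8 = 1 ∨ b % 8 = 7 then 1 else -1) : ℤ) : ℂ) := by
    by_cases hb : b % 2 = 0
    · rw [if_pos hb, MulChar.map_nonunit _ (not_isUnit_of_even (Or.inr rfl) hb), Int.cast_zero]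
    · rw [if_neg hb]
      have hbodd : Odd b := Nat.odd_iff.2 (by omega)
      rw [show ((b : ℕ) : ZMod (2 ^ 3)) = ((b : ℕ) : ZMod 8) from rfl,
        apply_natCast_eight_eq (isPrimitive_crtFst hcop hprim) (IsQuadratic.crtFst hcop hquad) hbodd,
        show (3 : ZMod 8) = (3 : ZMod (2 ^ 3)) from rfl, h3]
      have h8 : b % 8 = 1 ∨ b % 8 = 3 ∨ b % 8 = 5 ∨ b % 8 = 7 := by omega
      by_cases hm4 : m % 4 = 1 <;> rcases h8 with h | h | h | h <;> simp [h, hm4]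
  rw [show ((b : ℕ) : ZMod (8 * m)) = ((b : ℕ) : ZMod (2 ^ 3 * m)) from rfl, key, h2, hJ, Int.cast_mul]

end Values

/-! ## §3 `B_{1,ψ}` as an integer sum -/

section Bernoulli

variable {f : ℕ} [NeZero f]

/-- **`‖B_{1,ψ}‖ = |Σ_{b<f} F(b)(2b − f)| / (2f)`** whenever `ψ(b) = F(b) ∈ ℤ` for all `b < f` (`B_{1,ψ} = Σ_{b<f} ψ(b)(b/f − ½)`).
[cite: Lang1990, Ch. 2 §1 (definition of B_{1,χ})] -/
theorem norm_bernoulliOneChar_eq_natAbs_sum_div (ψ : DirichletCharacter ℂ f) {F : ℕ → ℤ}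
    (hF : ∀ b, b < f → ψ (b : ZMod f) = (F b : ℂ)) :
    ‖bernoulliOneChar ψ‖ = ((∑ b ∈ Finset.range f, F b * (2 * (b : ℤ) - f)).natAbs : ℝ) / (2 * f) := by
  have hf0 : (f : ℂ) ≠ 0 := Nat.cast_ne_zero.2 (NeZero.ne f)
  have hB : bernoulliOneChar ψ = ((∑ b ∈ Finset.range f, F b * (2 * (b : ℤ) - f) : ℤ) : ℂ) / (2 * f) := by
    rw [bernoulliOneChar_def, eq_div_iff (mul_ne_zero two_ne_zero hf0), Finset.sum_mul, Int.cast_sum]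
    refine Finset.sum_congr rfl fun b hb => ?_
    rw [hF b (Finset.mem_range.1 hb)]
    push_cast
    field_simp
  have h2f : ‖(2 * (f : ℂ))‖ = 2 * f := by
    rw [show (2 * (f : ℂ)) = ((2 * f : ℕ) : ℂ) by push_cast; ring, Complex.norm_natCast]; push_cast; ring
  rw [hB, norm_div, Complex.norm_intCast, h2f, Nat.cast_natAbs, Int.cast_abs]

/-- Reindexing the half sum: `Σ_{x : ℤ/f, 2⟨x⟩ < f} g(x) = Σ_{b < (f+1)/2} g(b)`. [folklore] -/
private theorem sum_filter_two_mul_val_lt_eq_sum_range (g : ZMod f → ℂ) :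
    ∑ x ∈ (Finset.univ : Finset (ZMod f)).filter (fun x => 2 * x.val < f), g x = ∑ b ∈ Finset.range ((f + 1) / 2), g (b : ZMod f) := by
  classical
  refine Finset.sum_nbij' (fun x => x.val) (fun b => (b : ZMod f)) ?_ ?_ ?_ ?_ ?_
  · intro x hx
    have h := (Finset.mem_filter.1 hx).2
    rw [Finset.mem_range]
    omega
  · intro b hb
    rw [Finset.mem_range] at hb
    have hbf : b < f := by omega
    refine Finset.mem_filter.2 ⟨Finset.mem_univ _, ?_⟩
    rw [ZMod.val_cast_of_lt hbf]
    omega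
  · intro x _
    exact ZMod.natCast_zmod_val x
  · intro b hb
    rw [Finset.mem_range] at hb
    exact ZMod.val_cast_of_lt (by omega)
  · intro x _
    rw [ZMod.natCast_zmod_val]

/-- A character with `ψ(2) = −1` (or `ψ(−1) = −1`) is not trivial. [folklore] -/
private theorem ne_one_of_apply_eq_neg_one {ψ : DirichletCharacter ℂ f} {x : ZMod f} (h : ψ x = -1) : ψ ≠ 1 := by
  rintro rfl
  by_cases hx : IsUnit x
  · rw [MulChar.one_apply hx] at h; norm_num at h
  · rw [MulChar.map_nonunit _ hx] at h; norm_num at h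

/-- **ODD `f`, `ψ(2) = −1`: `‖B_{1,ψ}‖ = |Σ_{b<(f+1)/2} F(b)| / 3`** whenever `ψ(b) = F(b) ∈ ℤ` for `b < f` (Ireland–Rosen:
`(1 − 2ψ(2))B_{1,ψ} = ψ(2)·Σ_{b<f/2}ψ(b)`; for the Legendre symbol at `p ≡ 3 (mod 8)`: `h(−p) = ⅓Σ_{x<p/2}(x/p)`).
[cite: IrelandRosen1982, Ch. 8 Exercise 28 (c); Ch. 15 §2] [cite: Lang1990, Ch. 2 §1] -/
theorem norm_bernoulliOneChar_eq_natAbs_halfSum_div_three (hf : Odd f) {ψ : DirichletCharacter ℂ f} (h2 : ψ (2 : ZMod f) = -1)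
    {F : ℕ → ℤ} (hF : ∀ b, b < f → ψ (b : ZMod f) = (F b : ℂ)) :
    ‖bernoulliOneChar ψ‖ = ((∑ b ∈ Finset.range ((f + 1) / 2), F b).natAbs : ℝ) / 3 := by
  have hψ : ψ ≠ 1 := ne_one_of_apply_eq_neg_one h2
  have hid := BernoulliOneCharBound.one_sub_two_mul_apply_two_mul_bernoulliOneChar_eq hf hψ
  rw [h2, sum_filter_two_mul_val_lt_eq_sum_range] at hid
  have hS : ∑ b ∈ Finset.range ((f + 1) / 2), ψ (b : ZMod f) = ((∑ b ∈ Finset.range ((f + 1) / 2), F b : ℤ) : ℂ) := by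
    rw [Int.cast_sum]
    refine Finset.sum_congr rfl fun b hb => hF b ?_
    have := Finset.mem_range.1 hb; omega
  rw [hS] at hid
  have hB : bernoulliOneChar ψ = -((∑ b ∈ Finset.range ((f + 1) / 2), F b : ℤ) : ℂ) / 3 := by
    rw [eq_div_iff (by norm_num : (3 : ℂ) ≠ 0)]
    linear_combination hid
  rw [hB, norm_div, norm_neg, Complex.norm_intCast, Nat.cast_natAbs, Int.cast_abs]
  norm_num

/-- **ODD `f`, `ψ(2) = +1`: `‖B_{1,ψ}‖ = |Σ_{b<(f+1)/2} F(b)|`** whenever `ψ(b) = F(b) ∈ ℤ` for `b < f` (Ireland–Rosen (d):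
`h(−p) = Σ_{x<p/2}(x/p)` for `p ≡ 7 (mod 8)`). [cite: IrelandRosen1982, Ch. 8 Exercise 28 (d); Ch. 15 §2] [cite: Lang1990, Ch. 2 §1] -/
theorem norm_bernoulliOneChar_eq_natAbs_halfSum (hf : Odd f) {ψ : DirichletCharacter ℂ f} (hψ : ψ ≠ 1) (h2 : ψ (2 : ZMod f) = 1)
    {F : ℕ → ℤ} (hF : ∀ b, b < f → ψ (b : ZMod f) = (F b : ℂ)) :
    ‖bernoulliOneChar ψ‖ = ((∑ b ∈ Finset.range ((f + 1) / 2), F b).natAbs : ℝ) := by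
  have hid := (BernoulliOneCharBound.norm_bernoulliOneChar_eq_norm_half_sum_of_apply_two_eq_one hf hψ h2).1
  rw [sum_filter_two_mul_val_lt_eq_sum_range] at hid
  have hS : ∑ b ∈ Finset.range ((f + 1) / 2), ψ (b : ZMod f) = ((∑ b ∈ Finset.range ((f + 1) / 2), F b : ℤ) : ℂ) := by
    rw [Int.cast_sum]
    refine Finset.sum_congr rfl fun b hb => hF b ?_
    have := Finset.mem_range.1 hb; omega
  rw [hid, hS, Complex.norm_intCast, Nat.cast_natAbs, Int.cast_abs]

end Bernoulli

end Literature.NumberTheory.LFunctions.PrimitiveQuadratic
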